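import Summits.ABC.IUTFork.Joshi.FundamentalEstimateBLStandardLifts
import Summits.ABC.IUTFork.Joshi.PrimitiveAnsatz
import Summits.ABC.IUTFork.Joshi.AnsatzStandardPoint
import HarnessLib

/-!
# [J-III] Thm. 7.3.1 — the standard-point norm values `StandardPointNorms` SUPPLIED one step further:
# E-t10's residual hypotheses (VS) «valuation scaling normalised at the last label» and (TS) «|ξ_1|_{K_{y_{ℓ⋇}}} = |q_w|^{1/2ℓ}»
# DERIVED from [J-IIp] Thm. 6.9.1 (E-t3's `PrototypeDatum`, kernel theorem `scale_ansatzPt`) + §5.1 + the STANDARD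
# NORMALISATION of §4.4–4.5; the one printed input that no typed carrier derives is LOCATED (block E, slot T-55)

Proof-only companion (abc-iut cell, block E «type Joshi's construction, test vs S», rung LADDER-ABC:A2.E; seat abc-iut-E-t8,
slot T-55 «SUPPLIER DISCHARGE `StandardPointNorms`», RE-POINT abc-iut-E-plan-2 07:13:52Z) of
`Joshi/FundamentalEstimateBLStandard.lean` (abc-iut-E-t12: the HYPOTHESIS `ATS3.AdelicThetaDatum.StandardPointNorms` =
«`|Ξ^{α_w}_{0,z_Θ,w,j}|_{B_{L′_w},ρ} = |q_w|_{ℂ_{p_w}}^{(1/2ℓ)(j²/ℓ⋇²)}`», proof of [J-III] Thm. 7.3.1, p.56 l.22–45) and of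
`Joshi/FundamentalEstimateBLStandardLifts.lean` (abc-iut-E-t10: `standardPointNorms_of_teichLifts` reduces it, over the §6.4
lift data, to the two printed claims (VS) `hscale` and (TS) `hq`). SOURCES: K. Joshi, arXiv:2401.13508v4 = [J-III]
(unrefereed; bib `Joshi2024ATS3`; render `HOME/lit/renders/Joshi-arxiv-2401.13508/`), arXiv:2303.01662v3 = [J-IIp] (bib
`Joshi2023ATS2Local`; render `HOME/lit/renders/Joshi-arxiv-2303.01662/`). TAKES NO SIDE on [IUTchIII] Cor. 3.12, on Joshi's
claims or on Mochizuki's report; typed ≠ proved ≠ endorsed. Object-side file (E-PLAN R14: imports Joshi object files only).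

WHAT IS PROVED (`ATS3.AdelicThetaDatum.standardPointNorms_of_prototype`). Keep E-t10's lift data verbatim. Suppose in addition
that at every `w ∈ 𝕍^{odd,ss}` the residue fields `K_{y′_{w,j}}` of the `w`-component of the standard point are read through a
one-prime prototype datum `P w : PrototypeDatum` of E-t3 (`Joshi/PrimitiveAnsatz.lean`, p428639: [J-IIp] §§2–7 — `|ι_y(z)|_{K_y} =
|z|_0^{scale y}` [FF18 Prop. 2.2.17], the primitive Ansatz points `y_j(a) = ([a^{j²}] − p)`, the Tate parameter `q` and the theta
value `ξ = ξ_1` with `|ξ|_0 = |q|_0^{1/2ℓ}` (§5.1)) on the SAME point type, glued to E-t10's/E-t12's data by three value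
identities — (G1) the same `ℓ⋇`; (G2) `|q|_0 = |q_w|_{ℂ_{p_w}}` (Thm. 7.3.1's normalisation, [J-III] p.55 l.3–9); (G3) "the theta
value `ξ_1` computed in `K_{y′_{w,j}}`" has the same absolute value in both carriers ([J-III] p.56 l.29–37) —, and that
(ANS) the `w`-component `(y′_{w,1}, …, y′_{w,ℓ⋇})` of `z_Θ` IS a point `(y_1(a), …, y_{ℓ⋇}(a))` of Mochizuki's primitive Ansatz ([J-III]
Def. 4.2.2 / (4.2.1.4) p.31–32: "`(y_{w,1}, …, y_{w,ℓ⋇}) ∈ Σ̃_{C♭_p,L′_w}` if `w ∈ 𝕍^{odd,ss}`", the local Ansatz being the inverse image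
of the primitive Ansatz [J-IIp] Def. 6.2.3), and
(STD) the last residue field is STANDARDLY NORMALISED, `scale (y′_{w,ℓ⋇}) = 1` — [J-III] §4.5 p.36 l.11–17 "`z_Θ = (y_1, …, y_{ℓ⋇}) ∈
Σ̃_{L′}` chosen such that `y_{ℓ⋇} = y′_0` is the standard point" with §4.4 p.35 l.87–97 "The residue field of the local ring of
`y′_w` … is an algebraically closed, perfectoid field which can be naturally identified with `ℂ_p`" and [J-IIp] p.27 l.8–12 "By
construction, `K_{ℓ⋇}` is the residue field of the canonical point of `𝒳_{ℂ♭_p,ℚ_p}` … `K_{ℓ⋇} = ℂ_p`".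
THEN (VS) and (TS) FOLLOW — (VS) is [J-IIp] (9.2.3) "`v_{K_j}(p) = j²·v_{K_1}(p) = (j²/ℓ⋇²)·v_{ℂ_p}(p)`" as a KERNEL THEOREM from
Thm. 6.9.1 (`PrototypeDatum.scale_ansatzPt`) + (STD) (`PrototypeDatum.scale_ansatzPt_of_std`); (TS) is §5.1 + (STD) + (G2) —, hence
`StandardPointNorms D`, hence Thm. 7.3.1 AS TYPED (`fundamentalEstimateBL_of_prototype`, via E-t12's
`fundamentalEstimateBL_of_standardPointNorms`) for every `ℓ ≥ 5`.

THE LOCATED INPUT (registry grammar: «E SUPPLY J3:Thm7.3.1/StandardPointNorms: DERIVED from J2p:Thm6.9.1 + J2p:§5.1 + J3:Def4.2.2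
MODULO (STD)»): (STD) is the ONLY hypothesis above that is neither carrier glue nor a definitional membership: the statement «a
closed classical point of `Y_{C♭_p,L′_w}` lying over the canonical point of `X` has residue field `ℂ_p` WITH ITS STANDARD
VALUATION (`scale = 1`)» — print's "naturally identified with `ℂ_p`" ([J-III] p.35 l.94–97) read together with [J-IIp] p.27 l.10–12;
a Fargues–Fontaine fact ([FF18] Thm. 6.5.2 / §10.1, as [J-III] §5.2 p.38 l.38–40 cites it) that no block-E carrier constructs. In
T-08's vocabulary it is the bridge from `AnsatzCurveDatum.IsStandardAnsatzPoint` (`Joshi/AnsatzStandardPoint.lean` p429131: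
`quot w (z_Θ last w) = canon w`, cf. `IsStandardAnsatzPoint.quot_last_eq_canon` below) to `scale (z_Θ last w) = 1`. No FACT-LIST
row is consumed; no new `Prop` is introduced (hypotheses inline, each with its locator); nothing is asserted.
-/

noncomputable section

namespace Summit.ABC.IUTFork.Joshi

/-! ## A. §4.4–4.5 in T-08's vocabulary: the last coordinate of `z_Θ` lies over the canonical point at every bad place -/

namespace AnsatzCurveDatum

/-- At a standard Ansatz point `z_Θ` ([J-III] §4.5) the last coordinate `y_{ℓ⋇,w} = y′_{0,w}` lies over the CANONICAL POINT of
`X_{C♭_{p_w},L′_w}` at every `w ∈ V^{odd,ss} ⊆ V^non` (Prop. 4.4.1) — the clause from which (STD) «`K_{y_{ℓ⋇,w}} = ℂ_p` with its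
standard valuation» is read in print (p.35 l.87–97). [folklore] -/
theorem IsStandardAnsatzPoint.quot_last_eq_canon {A : AnsatzCurveDatum} {z : A.Tuple} (h : A.IsStandardAnsatzPoint z)
    {w : A.V} (hw : w ∈ A.Voddss) : A.quot w (z A.last w) = A.canon w :=
  h.2 w (A.Voddss_subset_Vnon hw)

end AnsatzCurveDatum

/-! ## B. One prime: [J-IIp] (9.2.3) as a kernel theorem over E-t3's `PrototypeDatum` -/

namespace PrototypeDatum

variable {F B E0 : Type} [Field F] [CommRing B] [Field E0] {Y : Type} {K : Y → Type} [∀ y, Field (K y)] {G : Type}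
  (P : PrototypeDatum F B E0 Y K G)

/-- The last label `j = ℓ⋇` of an `ℓ⋇`-tuple (index `ℓ⋇ − 1`; `ℓ⋇ ≥ 1` in E-t3's datum). [folklore] -/
def lastIdx : Fin P.lstar := ⟨P.lstar - 1, by have := P.one_le_lstar; omega⟩

/-- `(lastIdx : ℕ) + 1 = ℓ⋇`. [folklore] -/
theorem val_lastIdx_add_one : (P.lastIdx : ℕ) + 1 = P.lstar := by
  have := P.one_le_lstar; unfold lastIdx; dsimp; omega

/-- **[J-IIp] (9.2.3), first half, DERIVED** (p.27 l.36–44: "`v_{K_j}(p) = j²·v_{K_1}(p)`", Thm. 6.9.1, here E-t3's kernel theorem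
`scale_ansatzPt`) **+ the standard normalisation**: if the last point `y_{ℓ⋇}(a)` of a primitive-Ansatz tuple has `scale = 1`
("`K_{ℓ⋇} = ℂ_p`", p.27 l.10–12), then `scale (y_j(a)) = j²/ℓ⋇²` for every label. [folklore] -/
theorem scale_ansatzPt_of_std {a : F} (ha : a ∈ P.AnsatzParam) (hstd : P.scale (P.ansatzPt a P.lastIdx) = 1)
    (i : Fin P.lstar) : P.scale (P.ansatzPt a i) = ((((i : ℕ) : ℝ) + 1) ^ 2) / ((P.lstar : ℝ) ^ 2) := by
  have h1 := P.scale_ansatzPt ha i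
  have h2 := P.scale_ansatzPt ha P.lastIdx
  rw [hstd] at h2
  have hl : (0 : ℝ) < (P.lstar : ℝ) := by have := P.one_le_lstar; exact_mod_cast this
  have hcast : ((((P.lastIdx : ℕ) + 1) ^ 2 : ℕ) : ℝ) = (P.lstar : ℝ) ^ 2 := by
    have h : ((P.lastIdx : ℕ) : ℝ) + 1 = (P.lstar : ℝ) := by exact_mod_cast P.val_lastIdx_add_one
    push_cast
    rw [h]
  rw [hcast] at h2
  -- `scale (pt a) = 1 / ℓ⋇²`
  have hpt : P.scale (P.pt a) = 1 / (P.lstar : ℝ) ^ 2 := by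
    field_simp
    linarith [h2]
  rw [h1, hpt]
  push_cast
  field_simp

/-- **[J-IIp] (9.2.3), the theta value in the `j`-th residue field** ("`|ξ|_{K_j} = |ξ|_{ℂ_p}^{j²/ℓ⋇²}`", p.27 l.45–p.28 l.8), DERIVED
under the standard normalisation. [folklore] -/
theorem absK_xi_ansatzPt_of_std {a : F} (ha : a ∈ P.AnsatzParam) (hstd : P.scale (P.ansatzPt a P.lastIdx) = 1)
    (i : Fin P.lstar) :
    P.absK (P.ansatzPt a i) (P.emb (P.ansatzPt a i) P.xi) = P.abs0 P.xi ^ (((((i : ℕ) : ℝ) + 1) ^ 2) / ((P.lstar : ℝ) ^ 2)) := by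
  rw [P.absK_emb, P.scale_ansatzPt_of_std ha hstd i]

/-- At the last label the theta value has its `ℂ_p`-size `|ξ|_0 = |q|_0^{1/2ℓ}` (§5.1 p.13 l.27–40; (STD)). [folklore] -/
theorem absK_xi_last_of_std {a : F} (hstd : P.scale (P.ansatzPt a P.lastIdx) = 1) :
    P.absK (P.ansatzPt a P.lastIdx) (P.emb (P.ansatzPt a P.lastIdx) P.xi) =
      P.abs0 P.q ^ (1 / (2 * ((2 * P.lstar + 1 : ℕ) : ℝ))) := by
  rw [P.absK_emb, hstd, Real.rpow_one, P.abs0_xi]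

/-- **(VS) normalised at the last label, DERIVED**: `|ξ|_{K_{y_j(a)}} = |ξ|_{K_{y_{ℓ⋇}(a)}}^{j²/ℓ⋇²}` ([J-III] Thm. 4.2.2.1 (4) between the
labels `j` and `ℓ⋇`, at a primitive-Ansatz tuple with the standard normalisation). [folklore] -/
theorem absK_xi_scaling_of_std {a : F} (ha : a ∈ P.AnsatzParam) (hstd : P.scale (P.ansatzPt a P.lastIdx) = 1)
    (i : Fin P.lstar) :
    P.absK (P.ansatzPt a i) (P.emb (P.ansatzPt a i) P.xi) =
      P.absK (P.ansatzPt a P.lastIdx) (P.emb (P.ansatzPt a P.lastIdx) P.xi) ^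
        (((((i : ℕ) : ℝ) + 1) ^ 2) / ((P.lstar : ℝ) ^ 2)) := by
  rw [P.absK_xi_ansatzPt_of_std ha hstd i, P.absK_emb, hstd, Real.rpow_one]

end PrototypeDatum

/-! ## C. The supply theorem over E-t12's adelic datum and E-t10's lift data -/

namespace ATS3

namespace AdelicThetaDatum

variable (D : AdelicThetaDatum)

/-- **`StandardPointNorms` from the one-prime prototypes (T-55).** E-t10's `standardPointNorms_of_teichLifts` with its two
residual printed claims DISCHARGED: (VS) by [J-IIp] Thm. 6.9.1 (`PrototypeDatum.scale_ansatzPt`, E-t3 p428639) + (STD), (TS) by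
[J-IIp] §5.1 (`PrototypeDatum.abs0_xi`) + (STD) + (G2). Hypotheses beyond E-t10's verbatim lift data (`L`, `hnrm`, `y`, `z`, `hz`,
`hXi`): the prototypes `P w` on the same point types; (G1) `hl`; (G2) `hq0` ([J-III] p.55 l.3–9); (G3) `hxi` ([J-III] p.56
l.29–37 "computed in the `ℓ⋇`-tuple of residue fields"); (ANS) `ha`/`hy` ([J-III] Def. 4.2.2, (4.2.1.4); [J-IIp] Def. 6.2.3);
(STD) `hstd` — THE LOCATED INPUT ([J-III] §4.5 p.36 l.11–17 + §4.4 p.35 l.87–97 + [J-IIp] p.27 l.8–12; [FF18]): the residue field at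
the last coordinate of `z_Θ` is `ℂ_p` with its standard valuation. Kernel glue only; no claim of Joshi's is asserted; no side
taken. [claim: Joshi2024ATS3, status: disputed] -/
theorem standardPointNorms_of_prototype {OE : D.W → Type} [∀ w, CommRing (OE w)] [∀ w, CommRing (D.B w)]
    [∀ w, Algebra (OE w) (D.B w)] {Y : D.W → Type} (L : ∀ w, ThetaLiftDatum (OE w) (D.B w) (Y w))
    (hnrm : ∀ w ∈ D.Vss, ∀ (ρ : ℝ) (x : D.B w), (L w).norm ρ x = D.nrm w ρ x)
    (y : ∀ w, Fin D.lstar → Y w) (z : ∀ w, Fin D.lstar → (L w).Cflat)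
    (hz : ∀ w ∈ D.Vss, ∀ i : Fin D.lstar, (L w).IsTeichLift (y w i) (z w i))
    (hXi : ∀ w ∈ D.Vss, D.Xi D.std w = (L w).admissibleLift (y w) (z w) (0 : OE w))
    {F B₀ E₀ : D.W → Type} [∀ w, Field (F w)] [∀ w, CommRing (B₀ w)] [∀ w, Field (E₀ w)]
    {K : ∀ w, Y w → Type} [∀ w (y : Y w), Field (K w y)] {G : D.W → Type}
    (P : ∀ w, PrototypeDatum (F w) (B₀ w) (E₀ w) (Y w) (K w) (G w))
    (hl : ∀ w ∈ D.Vss, (P w).lstar = D.lstar)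
    (hq0 : ∀ w ∈ D.Vss, (P w).abs0 (P w).q = D.qAbs w)
    (hxi : ∀ w ∈ D.Vss, ∀ i : Fin D.lstar,
      (L w).absK (y w i) ((L w).xi (y w i)) = (P w).absK (y w i) ((P w).emb (y w i) (P w).xi))
    (a : ∀ w, F w) (ha : ∀ w ∈ D.Vss, a w ∈ (P w).AnsatzParam)
    (hy : ∀ w (hw : w ∈ D.Vss) (i : Fin D.lstar), y w i = (P w).ansatzPt (a w) (Fin.cast (hl w hw).symm i))
    (hstd : ∀ w ∈ D.Vss, (P w).scale (y w D.lastLabel) = 1) :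
    D.StandardPointNorms := by
  -- bookkeeping: the cast of the last label is the prototype's last index
  have hlast : ∀ w (hw : w ∈ D.Vss), Fin.cast (hl w hw).symm D.lastLabel = (P w).lastIdx := by
    intro w hw
    apply Fin.ext
    simp only [Fin.val_cast, lastLabel, PrototypeDatum.lastIdx, hl w hw]
  -- (STD) transported to the prototype's last Ansatz point
  have hstdP : ∀ w (hw : w ∈ D.Vss), (P w).scale ((P w).ansatzPt (a w) (P w).lastIdx) = 1 := by
    intro w hw
    rw [← hlast w hw, ← hy w hw]
    exact hstd w hw
  refine D.standardPointNorms_of_teichLifts L hnrm y z hz hXi ?_ ?_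
  · -- (VS): valuation scaling normalised at the last label
    intro w hw i
    rw [hxi w hw i, hxi w hw D.lastLabel, hy w hw i, hy w hw D.lastLabel, hlast w hw,
      (P w).absK_xi_scaling_of_std (ha w hw) (hstdP w hw)]
    simp only [Fin.val_cast, hl w hw]
  · -- (TS): the theta value at the standard residue field
    intro w hw
    rw [hxi w hw D.lastLabel, hy w hw D.lastLabel, hlast w hw, (P w).absK_xi_last_of_std (hstdP w hw), hq0 w hw,
      hl w hw]
    simp [ell]

/-- **Thm. 7.3.1 AS TYPED (`FundamentalEstimateBL`) from the one-prime prototypes**, for every `ℓ ≥ 5`: composition with E-t12's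
`fundamentalEstimateBL_of_standardPointNorms`. Hypothesis set = E-t10's lift data ∧ (G1)–(G3) ∧ (ANS) ∧ (STD); the printed claims
[J-IIp] Thm. 6.9.1, §5.1, Prop. 7.4.2 are kernel theorems of the carriers. Kernel glue only. [claim: Joshi2024ATS3, status: disputed] -/
theorem fundamentalEstimateBL_of_prototype {OE : D.W → Type} [∀ w, CommRing (OE w)] [∀ w, CommRing (D.B w)]
    [∀ w, Algebra (OE w) (D.B w)] {Y : D.W → Type} (L : ∀ w, ThetaLiftDatum (OE w) (D.B w) (Y w))
    (hnrm : ∀ w ∈ D.Vss, ∀ (ρ : ℝ) (x : D.B w), (L w).norm ρ x = D.nrm w ρ x)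
    (y : ∀ w, Fin D.lstar → Y w) (z : ∀ w, Fin D.lstar → (L w).Cflat)
    (hz : ∀ w ∈ D.Vss, ∀ i : Fin D.lstar, (L w).IsTeichLift (y w i) (z w i))
    (hXi : ∀ w ∈ D.Vss, D.Xi D.std w = (L w).admissibleLift (y w) (z w) (0 : OE w))
    {F B₀ E₀ : D.W → Type} [∀ w, Field (F w)] [∀ w, CommRing (B₀ w)] [∀ w, Field (E₀ w)]
    {K : ∀ w, Y w → Type} [∀ w (y : Y w), Field (K w y)] {G : D.W → Type}
    (P : ∀ w, PrototypeDatum (F w) (B₀ w) (E₀ w) (Y w) (K w) (G w))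
    (hl : ∀ w ∈ D.Vss, (P w).lstar = D.lstar)
    (hq0 : ∀ w ∈ D.Vss, (P w).abs0 (P w).q = D.qAbs w)
    (hxi : ∀ w ∈ D.Vss, ∀ i : Fin D.lstar,
      (L w).absK (y w i) ((L w).xi (y w i)) = (P w).absK (y w i) ((P w).emb (y w i) (P w).xi))
    (a : ∀ w, F w) (ha : ∀ w ∈ D.Vss, a w ∈ (P w).AnsatzParam)
    (hy : ∀ w (hw : w ∈ D.Vss) (i : Fin D.lstar), y w i = (P w).ansatzPt (a w) (Fin.cast (hl w hw).symm i))
    (hstd : ∀ w ∈ D.Vss, (P w).scale (y w D.lastLabel) = 1) :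
    D.FundamentalEstimateBL :=
  D.fundamentalEstimateBL_of_standardPointNorms
    (D.standardPointNorms_of_prototype L hnrm y z hz hXi P hl hq0 hxi a ha hy hstd)

end AdelicThetaDatum

end ATS3

end Summit.ABC.IUTFork.Joshi

end
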